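import Literature.NumberTheory.EllipticCurves.HeegnerGeomTorsionDepthProofs
import Literature.NumberTheory.EllipticCurves.CastellaGrossiLeeSkinner2022.StabilizedHeegnerDataOfTowerProofs
import HarnessLib

/-!
# The COHERENT Heegner data on the principal CM system (CGLS 2022, Thm. 4.1.1 proof; Howard 2004,
# §2.7, §3.3; Perrin-Riou 1987, §3) — THEOREMS ONLY

Topic `NumberTheory/EllipticCurves`; namespace `Literature.NumberTheory.EllipticCurves`. No definition,
no named fact. Cell `pub/bsd-print-x9`, LEAD `bsd-line-x9-p1` (envelope infrastructure, part IV-d).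

The tree's two Heegner data structures — Howard's family `HeegnerFamily` (`y = Norm_{K[1]/K} P[1]`,
`z_j = Norm_{K[p^{j+1}]/K_j} P[p^{j+1}]`) and the `d(k)`-shifted datum
`CastellaGrossiLeeSkinner2022.StabilizedHeegnerData` (`u_k = Norm_{K[p^{d(k)}]/K_k} P[p^{d(k)}]`,
`v_k = Norm_{K_kK[p^{d(k)-1}]/K_k} P[p^{d(k)-1}]`) — only REQUIRE each point to be SOME norm of SOME
Heegner point of the right conductor (`IsHeegnerNormPoint`), so their instances may be Galois-incoherent
(module docstring of `HowardDivisibilityAnyClassNumber`, "Galois-INCOHERENT instances"). Print works with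
ONE system `P[p^j] = π(h_{p^j})`, `h_{p^j} = [ℂ/𝒪_{p^j} → ℂ/𝔑_{p^j}^{-1}]` (Howard 2004, §2.7; CGLS Thm. 4.1.1
proof: "`P_k[n] = Norm_{K[np^{d(k)}]/K_k[n]} P[np^{d(k)}]`"), for which the distribution relations hold on
the nose. This file BUILDS the coherent instances of both structures on the principal system of the tree
(`exists_geomPoint_principal`: the points `x_j ∈ E(K̄)` over `φ(x(p^j))`, `x(c) = heegnerPointOfConductor`),
together with the transversals through which every `y`, `z_j`, `u_k`, `v_k` is an explicit finite sum
`Σ_{r ∈ R} r • x_c` — the form in which the tree's distribution relations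
(`sum_transversal_smul_eq_frobeniusTrace_smul_sub_of_le`,
`sum_transversal_smul_eq_frobeniusTrace_smul_sub_prime_smul`, `sum_smul_eq_sum_sum_smul`,
`sum_smul_eq_of_transversal`) apply to them by name.

* §1 `exists_principalSystem` — the principal system `x : ℕ → E(K̄)`, `x_j` over `φ(x(p^j))`, with models
  `P_j ∈ E(K[p^j])`, each `x_j` a Heegner point of conductor `p^j` (`IsHeegnerGeomPoint`) fixed by
  `Gal(K̄/K[p^j])`.
* §2 `exists_heegnerFamily_of_system` — Howard's family ON a given system: `y = Σ_{t ∈ T} t • x_0`,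
  `z_j = Σ_{r ∈ R_j} r • x_{j+1}` for transversals `T` of `Gal(K̄/K[1])` in `Γ_K` and `R_j` of
  `Gal(K̄/K[p^{j+1}])` in `Gal(K̄/K_j)`.
* §3 `exists_stabilizedHeegnerData_of_system` — the CGLS datum ON a given system, under
  `K_k ⊆ K[p^{k+1}]` for all `k` (the anticyclotomic tower inside `K[p^∞]`, Perrin-Riou 1987 §1) and
  `#Gal(K[p]/K[1]) = p − 1` (`p` split, `𝒪_K^× = {±1}`): `d(k) = min {d : K_k ⊆ K[p^d]} ≤ k + 1`,
  `δ = max {k : K_k ⊆ K[1]}`, **`d(k) ≥ 2` for `k > δ`** (`ringClassSubgroup_one_le_of_ringClassSubgroup_prime_le`: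
  `d(k) = 1` would force `K_k ⊆ K[1]`), ONE transversal `A_k` of `Gal(K̄/K[p^{d(k)}])` in `Gal(K̄/K_k)`
  serving both `u_k = Σ_{a ∈ A_k} a • x_{d(k)}` and `v_k = Σ_{a ∈ A_k} a • x_{d(k)-1}` — the latter IS the
  norm from `K_kK[p^{d(k)-1}]` because `Gal(K̄/K_k) ⊓ Gal(K̄/K[p^{d(k)-1}]) = Gal(K̄/K[p^{d(k)}])`
  (`inf_ringClassSubgroup_eq_of_not_le`, the re-layering at `d(k) ≥ 2`).

## References

* [CastellaGrossiLeeSkinner2022] F. Castella, G. Grossi, J. Lee, C. Skinner, *On the anticyclotomic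
  Iwasawa theory of rational elliptic curves at Eisenstein primes*, Invent. Math. 227 (2022),
  Thm. 4.1.1 (proof: `d(k)`, `P_k[n]`) and Rem. 4.1.4 (arXiv:2008.02571v2, p. 22).
* [Howard2004HeegnerKolyvagin] B. Howard, *The Heegner point Kolyvagin system*, Compos. Math. 140
  (2004), §2.7 (`h_m`, `P[m] ∈ E(K[m])`), §3.3 (`H_k`).
* [PerrinRiou1987BSMF] B. Perrin-Riou, *Fonctions L p-adiques, théorie d'Iwasawa et points de
  Heegner*, Bull. SMF 115 (1987), §1, §3.1–3.4.
* [Cox2013] D. A. Cox, *Primes of the form x² + ny²*, 2nd ed. (2013), Thm. 7.24, Thm. 11.1.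
-/

noncomputable section

open scoped Classical

namespace Literature.NumberTheory.EllipticCurves

open WeierstrassCurve RingClassField ModularForms

variable {K : Type} [Field K] [NumberField K]

/-! ### §1 The principal CM system along the `p`-power conductors -/

/-- **The principal system of Heegner points of conductors `p^j`** (Howard 2004, §2.7: `P[m] = π(h_m)`,
`h_m = [ℂ/𝒪_m → ℂ/𝔑_m^{-1}]`; CGLS 2022, Thm. 4.1.1 proof): for `K` imaginary quadratic with the Heegner
hypothesis for `N`, `4N ∣ β² − d_K`, a prime `p ∤ N`, there are points `x_j ∈ E(K̄)` (`j ≥ 0`) with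
`(x_j)_ℂ = φ(x(p^j))`, models `P_j ∈ E(K[p^j])` over the same complex point, each `x_j` a Heegner point of
conductor `p^j` fixed by `Gal(K̄/K[p^j])`.
[cite: Howard2004HeegnerKolyvagin, §2.7 (P[m] ∈ E(K[m]))] [cite: GrossLMS1991, §3 (x_n rational over K_n)] -/
theorem exists_principalSystem {N : ℕ} [NeZero N] {W : WeierstrassCurve ℚ} [W.IsElliptic]
    (hK : IsImaginaryQuadratic K) (hH : SatisfiesHeegnerHypothesis N K) (Dt : ModularParametrizationData W N)
    {β : ℤ} (hβ : (4 * N : ℤ) ∣ β ^ 2 - NumberField.discr K) (jbar : AlgebraicClosure K →+* ℂ)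
    {p : ℕ} (hp : p.Prime) (hpN : ¬ p ∣ N) :
    ∃ (x : ℕ → WeierstrassCurve.geomPoints (W.baseChange K))
      (P : ∀ j : ℕ,
        (W.baseChange (ringClassField K (jbar.comp (algebraMap K (AlgebraicClosure K))) (p ^ j))).toAffine.Point),
      ∀ j, complexPoint W jbar (x j) = heegnerPointComplexOfConductor Dt (NumberField.discr K) β (p ^ j) ∧
        WeierstrassCurve.Affine.Point.map (W' := W)
          (ringClassField K (jbar.comp (algebraMap K (AlgebraicClosure K))) (p ^ j)).subtype.toRatAlgHom
            (P j) = heegnerPointComplexOfConductor Dt (NumberField.discr K) β (p ^ j) ∧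
        IsHeegnerGeomPoint N W K Dt β (p ^ j) jbar (x j) ∧
        ∀ σ ∈ ringClassSubgroup K (p ^ j) jbar, σ • x j = x j := by
  have hc : ∀ j : ℕ, (p ^ j).Coprime N := fun j ↦
    Nat.Coprime.pow_left _ (hp.coprime_iff_not_dvd.mpr hpN)
  choose x P hx using fun j : ℕ ↦
    exists_geomPoint_principal hK hH Dt hβ jbar (c := p ^ j) (pow_ne_zero _ hp.ne_zero) (hc j)
  exact ⟨x, P, hx⟩

/-! ### §2 Howard's family on a given system -/

/-- **Howard's Heegner family ON a system of points** (Howard 2004, §3.3: `H_k` is generated by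
`Norm_{K[1]/K} P[1]` and the `Norm_{K[p^{j+1}]/K_j} P[p^{j+1}]`, `j ≤ k`; Perrin-Riou 1987, §3.4): given
Heegner points `x_j` of conductor `p^j` fixed by `Gal(K̄/K[p^j])`, there is a `HeegnerFamily` with the
given `Dt`, `β` whose points are the explicit norms `y = Σ_{t ∈ T} t • x_0` and
`z_j = Σ_{r ∈ R_j} r • x_{j+1}` over transversals `T` of `Gal(K̄/K[1])` in `Γ_K = Gal(K̄/K_0)` and `R_j` of
`Gal(K̄/K[p^{j+1}])` in `Gal(K̄/K_j)`.
[cite: Howard2004HeegnerKolyvagin, §3.3 (H_k, before Thm. 3.3.7)] [cite: PerrinRiou1987BSMF, §3.4] -/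
theorem exists_heegnerFamily_of_system {N : ℕ} [NeZero N] {W : WeierstrassCurve ℚ}
    (Dt : ModularParametrizationData W N) {β : ℤ} (hβ : (4 * N : ℤ) ∣ β ^ 2 - NumberField.discr K)
    (jbar : AlgebraicClosure K →+* ℂ) {p : ℕ} [Fact p.Prime] (κ : ZpExtension K p)
    {x : ℕ → WeierstrassCurve.geomPoints (W.baseChange K)} (hgeom : ∀ j, IsHeegnerGeomPoint N W K Dt β (p ^ j) jbar (x j))
    (hfix : ∀ j, ∀ σ ∈ ringClassSubgroup K (p ^ j) jbar, σ • x j = x j) :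
    ∃ (F : HeegnerFamily N W K κ jbar) (T : Finset (Field.absoluteGaloisGroup K))
      (R : ℕ → Finset (Field.absoluteGaloisGroup K)),
      F.Dt = Dt ∧ F.β = β ∧
      ((∀ t ∈ T, t ∈ κ.layerSubgroup 0) ∧
        ∀ τ ∈ κ.layerSubgroup 0, ∃! t, t ∈ T ∧ t⁻¹ * τ ∈ ringClassSubgroup K 1 jbar) ∧
      F.y = ∑ t ∈ T, t • x 0 ∧
      (∀ j, (∀ r ∈ R j, r ∈ κ.layerSubgroup j) ∧
        ∀ τ ∈ κ.layerSubgroup j, ∃! r, r ∈ R j ∧ r⁻¹ * τ ∈ ringClassSubgroup K (p ^ (j + 1)) jbar) ∧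
      ∀ j, F.z j = ∑ r ∈ R j, r • x (j + 1) := by
  have hT : ∃ T : Finset (Field.absoluteGaloisGroup K), (∀ t ∈ T, t ∈ κ.layerSubgroup 0) ∧
      ∀ τ ∈ κ.layerSubgroup 0, ∃! t, t ∈ T ∧ t⁻¹ * τ ∈ ringClassSubgroup K 1 jbar := by
    haveI := finiteIndex_ringClassSubgroup K 1 jbar
    exact exists_finset_transversal' _ _
  obtain ⟨T, hTmem, hTtr⟩ := hT
  have hR : ∀ j : ℕ, ∃ R : Finset (Field.absoluteGaloisGroup K), (∀ r ∈ R, r ∈ κ.layerSubgroup j) ∧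
      ∀ τ ∈ κ.layerSubgroup j, ∃! r, r ∈ R ∧ r⁻¹ * τ ∈ ringClassSubgroup K (p ^ (j + 1)) jbar := by
    intro j
    haveI := finiteIndex_ringClassSubgroup K (p ^ (j + 1)) jbar
    exact exists_finset_transversal' _ _
  choose R hRmem hRtr using hR
  have hgeom0 : IsHeegnerGeomPoint N W K Dt β 1 jbar (x 0) := by simpa using hgeom 0
  have hfix0 : ∀ σ ∈ ringClassSubgroup K 1 jbar, σ • x 0 = x 0 := by simpa using hfix 0
  refine ⟨{ Dt := Dt
            β := β
            dvd_sq_sub := hβ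
            y := ∑ t ∈ T, t • x 0
            isHeegnerNormPoint_y := ⟨x 0, T, hgeom0, hfix0, fun t ht ↦ hTmem t (Finset.mem_coe.mp ht),
              hTtr, rfl⟩
            z := fun j ↦ ∑ r ∈ R j, r • x (j + 1)
            isHeegnerNormPoint_z := fun j ↦ ⟨x (j + 1), R j, hgeom (j + 1), hfix (j + 1),
              fun r hr ↦ hRmem j r (Finset.mem_coe.mp hr), hRtr j, rfl⟩ },
    T, R, rfl, rfl, ⟨hTmem, hTtr⟩, rfl, fun j ↦ ⟨hRmem j, hRtr j⟩, fun j ↦ rfl⟩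

/-! ### §3 The CGLS datum on a given system, with one transversal for `u_k` and `v_k` -/

/-- **The coherent `d(k)`-shifted datum ON a system of points** (CGLS 2022, Thm. 4.1.1 proof:
"`d(k) = min{d ∈ ℤ_{≥0} : K_k ⊂ K[p^d]}`", "`P_k[n] = Norm_{K[np^{d(k)}]/K_k[n]} P[np^{d(k)}]`"; Rem. 4.1.4).
For `K` imaginary quadratic, a prime `p` with `#Gal(K[p]/K[1]) = p − 1` (`p` split, `𝒪_K^× = {±1}`:
Cox Thm. 7.24), a `ℤ_p`-extension `κ` with `K_k ⊆ K[p^{k+1}]` for all `k` (the anticyclotomic tower), and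
Heegner points `x_j` of conductor `p^j` fixed by `Gal(K̄/K[p^j])`: there is a
`StabilizedHeegnerData` with the given `Dt`, `β`, with `d(k) ≤ k + 1`, **`d(k) ≥ 2` for `k > δ`**, and ONE
transversal `A_k ⊆ Gal(K̄/K_k)` of `Gal(K̄/K[p^{d(k)}])` for each `k` such that
`u_k = Σ_{a ∈ A_k} a • x_{d(k)}` and `v_k = Σ_{a ∈ A_k} a • x_{d(k)-1}` (the second sum is the norm from
`K_kK[p^{d(k)-1}]` by the re-layering `Gal(K̄/K_k) ⊓ Gal(K̄/K[p^{d(k)-1}]) = Gal(K̄/K[p^{d(k)}])`).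
[cite: CastellaGrossiLeeSkinner2022, Thm. 4.1.1 proof (d(k), P_k[n]; arXiv:2008.02571v2 p. 22) and Rem. 4.1.4]
[cite: Cox2013, Thm. 7.24] [cite: PerrinRiou1987BSMF, §1 and §3.1] -/
theorem exists_stabilizedHeegnerData_of_system {N : ℕ} [NeZero N] {W : WeierstrassCurve ℚ}
    (hK : IsImaginaryQuadratic K) (Dt : ModularParametrizationData W N) {β : ℤ}
    (hβ : (4 * N : ℤ) ∣ β ^ 2 - NumberField.discr K) (jbar : AlgebraicClosure K →+* ℂ) {p : ℕ}
    [Fact p.Prime] (κ : ZpExtension K p)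
    (hTw1 : ∀ k, ringClassSubgroup K (p ^ (k + 1)) jbar ≤ κ.layerSubgroup k)
    (hcardp : Nat.card (ringClassGalOver (jbar.comp (algebraMap K (AlgebraicClosure K))) p 1) = p - 1)
    {x : ℕ → WeierstrassCurve.geomPoints (W.baseChange K)} (hgeom : ∀ j, IsHeegnerGeomPoint N W K Dt β (p ^ j) jbar (x j))
    (hfix : ∀ j, ∀ σ ∈ ringClassSubgroup K (p ^ j) jbar, σ • x j = x j) :
    ∃ (C : CastellaGrossiLeeSkinner2022.StabilizedHeegnerData N W K κ jbar)
      (A : ℕ → Finset (Field.absoluteGaloisGroup K)),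
      C.Dt = Dt ∧ C.β = β ∧ (∀ k, C.d k ≤ k + 1) ∧ (∀ k, C.depth < k → 2 ≤ C.d k) ∧
      (∀ k, (∀ a ∈ A k, a ∈ κ.layerSubgroup k) ∧
        ∀ τ ∈ κ.layerSubgroup k, ∃! a, a ∈ A k ∧ a⁻¹ * τ ∈ ringClassSubgroup K (p ^ C.d k) jbar) ∧
      (∀ k, C.u k = ∑ a ∈ A k, a • x (C.d k)) ∧
      ∀ k, C.v k = ∑ a ∈ A k, a • x (C.d k - 1) := by
  have hp : p.Prime := Fact.out
  have hTw : ∀ k : ℕ, ∃ d : ℕ, ringClassSubgroup K (p ^ d) jbar ≤ κ.layerSubgroup k :=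
    fun k ↦ ⟨k + 1, hTw1 k⟩
  -- the shift `d(k)` and its bound
  set d : ℕ → ℕ := fun k ↦ Nat.find (hTw k) with hd_def
  have hd_le : ∀ k, d k ≤ k + 1 := fun k ↦ Nat.find_min' (hTw k) (hTw1 k)
  have hd_spec : ∀ k, ringClassSubgroup K (p ^ d k) jbar ≤ κ.layerSubgroup k := fun k ↦
    Nat.find_spec (hTw k)
  have hd_min : ∀ k d', d' < d k → ¬ ringClassSubgroup K (p ^ d') jbar ≤ κ.layerSubgroup k :=
    fun k _ hd' ↦ Nat.find_min (hTw k) hd'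
  -- the torsion depth `δ = max {k : K_k ⊆ K[1]}`
  let P : ℕ → Prop := fun k ↦ ringClassSubgroup K 1 jbar ≤ κ.layerSubgroup k
  have hP0 : P 0 := by
    show ringClassSubgroup K 1 jbar ≤ κ.layerSubgroup 0
    rw [ZpExtension.layerSubgroup_zero]; exact le_top
  set δ : ℕ := Nat.findGreatest P (ringClassSubgroup K 1 jbar).index with hδ_def
  have hδ : P δ := Nat.findGreatest_spec (P := P) (Nat.zero_le _) hP0
  have hiff : ∀ k, P k ↔ k ≤ δ := fun k ↦
    ⟨fun hk ↦ Nat.le_findGreatest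
        (CastellaGrossiLeeSkinner2022.StabilizedHeegnerData.le_index_of_ringClassSubgroup_one_le hk) hk,
      fun hk ↦ le_trans hδ (κ.layerSubgroup_antitone hk)⟩
  have hd0 : ∀ k, d k = 0 ↔ k ≤ δ := fun k ↦ by
    rw [hd_def, Nat.find_eq_zero, pow_zero]; exact hiff k
  -- `d(k) ≥ 2` above the depth: `d(k) = 1` would give `K_k ⊆ K[p]`, hence `K_k ⊆ K[1]`
  have htwo : ∀ k, δ < k → 2 ≤ d k := by
    intro k hk
    by_contra hlt
    rcases Nat.lt_succ_iff.mp (not_le.mp hlt) |>.eq_or_lt with h1 | h0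
    · have hle : ringClassSubgroup K p jbar ≤ κ.layerSubgroup k := by
        simpa [h1] using hd_spec k
      have h1le : ringClassSubgroup K 1 jbar ≤ κ.layerSubgroup k :=
        ringClassSubgroup_one_le_of_ringClassSubgroup_prime_le hK jbar hp hcardp
          (κ.index_layerSubgroup k) hle
      exact absurd ((hiff k).mp h1le) (not_le.mpr hk)
    · have h0' : d k = 0 := by omega
      exact absurd ((hd0 k).mp h0') (not_le.mpr hk)
  -- the re-layering `Gal(K̄/K_k) ⊓ Gal(K̄/K[p^{d(k)-1}]) = Gal(K̄/K[p^{d(k)}])` for `k > δ`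
  have hrel : ∀ k, δ < k →
      κ.layerSubgroup k ⊓ ringClassSubgroup K (p ^ (d k - 1)) jbar = ringClassSubgroup K (p ^ d k) jbar :=
    fun k hk ↦ inf_ringClassSubgroup_eq_of_not_le hK jbar hp (htwo k hk) (hd_spec k)
      (hd_min k _ (by have := htwo k hk; omega))
  -- one transversal `A_k` of `Gal(K̄/K[p^{d(k)}])` in `Gal(K̄/K_k)` for every `k`
  have hA : ∀ k : ℕ, ∃ A : Finset (Field.absoluteGaloisGroup K), (∀ a ∈ A, a ∈ κ.layerSubgroup k) ∧
      ∀ τ ∈ κ.layerSubgroup k, ∃! a, a ∈ A ∧ a⁻¹ * τ ∈ ringClassSubgroup K (p ^ d k) jbar := by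
    intro k
    haveI := finiteIndex_ringClassSubgroup K (p ^ d k) jbar
    exact exists_finset_transversal' _ _
  choose A hAmem hAtr using hA
  -- `A_k` is also a transversal for `Gal(K̄/K[p^{d(k)-1}])`, `k > δ` (re-layering)
  have hAtr' : ∀ k, δ < k → ∀ τ ∈ κ.layerSubgroup k,
      ∃! a, a ∈ A k ∧ a⁻¹ * τ ∈ ringClassSubgroup K (p ^ (d k - 1)) jbar := by
    intro k hk τ hτ
    have hanti : ringClassSubgroup K (p ^ d k) jbar ≤ ringClassSubgroup K (p ^ (d k - 1)) jbar :=
      ringClassSubgroup_anti hK jbar (pow_dvd_pow p (Nat.sub_le _ _)) (pow_ne_zero _ hp.ne_zero)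
    obtain ⟨a, ⟨haA, ha⟩, huniq⟩ := hAtr k τ hτ
    refine ⟨a, ⟨haA, hanti ha⟩, fun b hb ↦ huniq b ⟨hb.1, ?_⟩⟩
    have hbL : b⁻¹ * τ ∈ κ.layerSubgroup k :=
      (κ.layerSubgroup k).mul_mem ((κ.layerSubgroup k).inv_mem (hAmem k b hb.1)) hτ
    have hmem : b⁻¹ * τ ∈ κ.layerSubgroup k ⊓ ringClassSubgroup K (p ^ (d k - 1)) jbar :=
      Subgroup.mem_inf.mpr ⟨hbL, hb.2⟩
    rwa [hrel k hk] at hmem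
  refine ⟨{ Dt := Dt
            β := β
            dvd_sq_sub := hβ
            d := d
            layer_le := hd_spec
            d_min := hd_min
            depth := δ
            d_eq_zero_iff := hd0
            u := fun k ↦ ∑ a ∈ A k, a • x (d k)
            isHeegnerNormPoint_u := fun k _ ↦ ⟨x (d k), A k, hgeom (d k), hfix (d k),
              fun a ha ↦ hAmem k a (Finset.mem_coe.mp ha), hAtr k, rfl⟩
            v := fun k ↦ ∑ a ∈ A k, a • x (d k - 1)
            isHeegnerNormPoint_v := fun k hk ↦ ⟨x (d k - 1), A k, hgeom (d k - 1), hfix (d k - 1),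
              fun a ha ↦ hAmem k a (Finset.mem_coe.mp ha), hAtr' k hk, rfl⟩ },
    A, rfl, rfl, hd_le, htwo, fun k ↦ ⟨hAmem k, hAtr k⟩, fun k ↦ rfl, fun k ↦ rfl⟩

end Literature.NumberTheory.EllipticCurves

end
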